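import Summits.Ventures.HSemireg.WedgeHankelRecurrenceSignatureSturm
import Summits.Ventures.HSemireg.WedgeHankelRecurrenceSignature
import Summits.Ventures.HSemireg.WedgeHankelRecurrenceInertiaRank

/-!
# Venture HSemireg — `Rank(Her(P,Q))` AS A MATRIX RANK FOR EVERY SIZE: for `P ∈ ℝ[X]` monic with `deg P ≤ t + 1` and any `Q`, **`rank H_t(Q·P′/P) = #{z ∈ Zer(P,ℂ) | Q(z) ≠ 0}`** and `rank H_t(P′/P) = #Zer(P,ℂ)`;
# for `m` monic split over an ordered field with `deg m ≤ t + 1`, **`rank H_t(a·m′/m) = #{λ ∈ roots(m) | a(λ) ≠ 0}`** — N113's square-size rank theorems extended to all Hankel sizes `t + 1 ≥ deg` through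
# N132's «matrix rank = inertia rank» and the inertia counts of N127 ∕ N129; with the real-rooted criterion **`P` splits over `ℝ` ⟺ `sigNeg H_t(P′/P) = 0` ⟺ `H_t(P′/P) ⪰ 0`** for every `t + 1 ≥ deg P`

HONEST FRAMING. Part of the Lean index of the computation cell `pub-hsemireg` (seat p10 gen 33, Sunday typer «UNIFORM-IN-n»).
LINEAR ALGEBRA OF HANKEL (catalecticant) MATRICES and of real ∕ complex polynomials ONLY (Mathlib's `sigPos` ∕ `sigNeg`, `Matrix.rank`, `Polynomial.roots` ∕ `aroots ℂ`): no variety, no cohomology theory, no sheaf, no Ext group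
and no semiregularity map is constructed here; nothing here says that HC / HC_CM / HC_AV holds; no Literature fact is declared or used.
SOURCE (classical): S. Basu, R. Pollack, M.-F. Roy, *Algorithms in Real Algebraic Geometry* (2nd ed. 2006) §4.3.2 Theorem 4.57 (Hermite) «`Rank(Her(P,Q)) = #{x ∈ C | P(x) = 0 ∧ Q(x) ≠ 0}`», Theorem 4.58
(«the signature of `Her(P,1)` is the number of roots of `P` in R» — so `P` has all its roots real iff the signature equals the rank iff `Her(P,1) ⪰ 0`, the real-rootedness criterion of Remark 4.59 ∕ §9).
DEDUP DISCLOSURE (`rg` of the whole tree): N113 (`WedgeHankelRecurrenceCommonRoots`) proves the rank clause for the SQUARE size `t + 1 = deg m` over any field via gcd's; PROVED Literature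
`HermiteRankSignature.rank_hermiteMatrix` is `Q = 1` over `ℝ` for `n ≥ deg P` (eigenvalues); `HermiteRealRootedness.splits_iff_posSemidef_hermiteMatrix` is the PSD criterion for `hermiteMatrix P n` (`Matrix.PosSemidef`); `Geometry/Lorentzian/PseudoRiemannianMetricProofs.sigNeg_eq_zero_of_nonneg` (over `ℝ`)
and `QuadraticForm/SignatureOrthogonalFamily.sigNeg_eq_zero_of_posDef` are the nearest forms of the bookkeeping lemma `sigNeg_eq_zero_of_nonneg` (here: any ordered field, semidefinite);
here the criterion is phrased by Mathlib's `sigNeg` of the Hankel form and the rank statements hold for every size `t + 1 ≥ deg` with a weight — corollaries of N127 ∕ N129 ∕ N132, nothing restated.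

WHAT IS IN THE TREE ∕ KEYED.  N132 (`WedgeHankelRecurrenceInertiaRank`): `rank_hankelSq_eq_sigPos_add_sigNeg`.  N129 (`WedgeHankelRecurrenceSignatureSturm`): `sigPos_add_sigNeg_hankelSq_dualSeq_mul_derivative_real`,
`sigPos_add_sigNeg_hankelSq_dualSeq_derivative_real`.  N128: `sigPos_sigNeg_hankelSq_dualSeq_mul_derivative_real`.  N127 (`WedgeHankelRecurrenceSignature`): `sigPos_add_sigNeg_hankelSq_dualSeq_mul_derivative`,
`sigPos_hankelSq_dualSeq_derivative`, `toQuadraticForm'_hankelSq_dualSeq_derivative_nonneg`.  N126: `sigPos_comp_le`.  Mathlib: `Polynomial.splits_iff_card_roots`, `IsAlgClosed.splits`.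
THIS FILE (namespace `Summit.Ventures.HSemireg.Wedge.HankelOuter` continued; CHAINED on N129 + N127 + N132; 0 definitions):
* §718 **`rank_hankelSq_dualSeq_mul_derivative_real_of_le`** (`rank H_t(Q·P′/P) = #{z ∈ Zer(P,ℂ) | Q(z) ≠ 0}`, `deg P ≤ t + 1`), `rank_hankelSq_dualSeq_derivative_real_of_le` (`= #Zer(P,ℂ)`),
  **`rank_hankelSq_dualSeq_mul_derivative_of_splits_of_le`** (split ordered case: `#{λ | a(λ) ≠ 0}`), `rank_hankelSq_dualSeq_derivative_of_splits_of_le` (`= #roots`).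
* §719 REAL-ROOTEDNESS BY INERTIA: `card_roots_toFinset_add_two_mul_eq_card_aroots` (`#roots_ℝ + 2·#upper = #Zer(P,ℂ)`), `sigNeg_hankelSq_dualSeq_derivative_real_eq_card_upper` (`sigNeg H_t(P′/P)` = number of
  conjugate pairs), `splits_iff_forall_im_eq_zero`, `splits_iff_card_upper_eq_zero`, **`splits_iff_sigNeg_hankelSq_eq_zero`** (`P` splits over `ℝ` ⟺ `sigNeg H_t(P′/P) = 0`, any `t + 1 ≥ deg P`),
  `sigNeg_eq_zero_of_nonneg` (bookkeeping: a form `≥ 0` has no negative line), **`splits_iff_hankelSq_nonneg`** (⟺ `vᵀ H_t(P′/P) v ≥ 0` for all real `v`).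
Nothing Ext-side.  New names only.
-/

open Module Polynomial
open scoped Matrix Polynomial ComplexConjugate

namespace Summit.Ventures.HSemireg.Wedge.HankelOuter

open Summit.Ventures.HSemireg.Wedge Summit.Ventures.HSemireg.Wedge.Hankel

/-! ## §718. The rank clause for every Hankel size `t + 1 ≥ deg` -/

/-- **`rank H_t(Q·P′/P) = #{z ∈ Zer(P,ℂ) | Q(z) ≠ 0}` for `P ∈ ℝ[X]` monic with `deg P ≤ t + 1` and any `Q`** (BPR Thm. 4.57, rank clause, every size). [this file, §718] -/
theorem rank_hankelSq_dualSeq_mul_derivative_real_of_le {t : ℕ} {P : ℝ[X]} (hP : P.Monic) (hPd : P.natDegree ≤ t + 1) (Q : ℝ[X]) :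
    (hankelSq ℝ t (dualSeq ℝ P (Q * derivative P))).rank = ((P.aroots ℂ).toFinset.filter fun z => (Q.map (algebraMap ℝ ℂ)).eval z ≠ 0).card := by
  rw [rank_hankelSq_eq_sigPos_add_sigNeg, sigPos_add_sigNeg_hankelSq_dualSeq_mul_derivative_real hP hPd]

/-- **`rank H_t(P′/P) = #Zer(P, ℂ)`** (distinct complex roots; `P` monic real, `deg P ≤ t + 1`; BPR Thm. 4.58 rank clause, every size). [this file, §718] -/
theorem rank_hankelSq_dualSeq_derivative_real_of_le {t : ℕ} {P : ℝ[X]} (hP : P.Monic) (hPd : P.natDegree ≤ t + 1) :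
    (hankelSq ℝ t (dualSeq ℝ P (derivative P))).rank = (P.aroots ℂ).toFinset.card := by
  rw [rank_hankelSq_eq_sigPos_add_sigNeg, sigPos_add_sigNeg_hankelSq_dualSeq_derivative_real hP hPd]

section Ordered

variable {K : Type*} [Field K] [LinearOrder K] [IsStrictOrderedRing K] [DecidableEq K]

/-- **Split case over an ordered field: `rank H_t(a·m′/m) = #{λ ∈ roots(m) | a(λ) ≠ 0}` for `m` monic split with `deg m ≤ t + 1`** (N113 needs `deg m = t + 1`). [this file, §718] -/
theorem rank_hankelSq_dualSeq_mul_derivative_of_splits_of_le {t : ℕ} {m : K[X]} (hm : m.Monic) (hs : m.Splits) (hmd : m.natDegree ≤ t + 1) (a : K[X]) :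
    (hankelSq K t (dualSeq K m (a * derivative m))).rank = (m.roots.toFinset.filter fun c => a.eval c ≠ 0).card := by
  rw [rank_hankelSq_eq_sigPos_add_sigNeg, sigPos_add_sigNeg_hankelSq_dualSeq_mul_derivative hm hs hmd]

/-- **Split case, `a = 1`: `rank H_t(m′/m) = #(distinct roots)` for every `t + 1 ≥ deg m`.** [this file, §718] -/
theorem rank_hankelSq_dualSeq_derivative_of_splits_of_le {t : ℕ} {m : K[X]} (hm : m.Monic) (hs : m.Splits) (hmd : m.natDegree ≤ t + 1) :
    (hankelSq K t (dualSeq K m (derivative m))).rank = m.roots.toFinset.card := by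
  obtain ⟨h1, h2⟩ := sigPos_hankelSq_dualSeq_derivative hm hs hmd
  rw [rank_hankelSq_eq_sigPos_add_sigNeg, h1, h2, add_zero]

end Ordered

/-! ## §719. Real-rootedness by inertia: `P` splits over `ℝ` iff `H_t(P′/P)` has no negative square -/

/-- `#roots_ℝ(P) + 2·#{z ∈ Zer(P,ℂ) | Im z > 0} = #Zer(P,ℂ)` for a real `P ≠ 0` (distinct roots). [this file, §719] -/
theorem card_roots_toFinset_add_two_mul_eq_card_aroots {P : ℝ[X]} (hP : P ≠ 0) :
    P.roots.toFinset.card + 2 * ((P.aroots ℂ).toFinset.filter fun z => 0 < z.im).card = (P.aroots ℂ).toFinset.card := by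
  have h := card_aroots_toFinset_filter_eval_ne_zero hP 1
  have hne : ∀ z : ℂ, ((1 : ℝ[X]).map (algebraMap ℝ ℂ)).eval z ≠ 0 := fun z => by rw [Polynomial.map_one, eval_one]; exact one_ne_zero
  rw [Finset.filter_true_of_mem fun z _ => hne z, Finset.filter_true_of_mem fun x _ => by rw [eval_one]; exact one_ne_zero, Finset.filter_congr fun z _ => and_iff_left (hne z)] at h
  exact h.symm

/-- **`sigNeg H_t(P′/P) = #{z ∈ Zer(P,ℂ) | Im z > 0}` = the number of conjugate pairs of non-real roots** (`P` monic real, `deg P ≤ t + 1`). [this file, §719] -/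
theorem sigNeg_hankelSq_dualSeq_derivative_real_eq_card_upper {t : ℕ} {P : ℝ[X]} (hP : P.Monic) (hPd : P.natDegree ≤ t + 1) :
    sigNeg (hankelSq ℝ t (dualSeq ℝ P (derivative P))).toQuadraticForm' = ((P.aroots ℂ).toFinset.filter fun z => 0 < z.im).card := by
  have h := (sigPos_sigNeg_hankelSq_dualSeq_mul_derivative_real hP hPd 1).2
  rw [one_mul] at h
  rw [h, Finset.filter_eq_empty_iff.2 fun x _ hx => absurd hx (by rw [eval_one]; exact not_lt.2 zero_le_one), Finset.card_empty, zero_add]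
  exact congrArg Finset.card (Finset.filter_congr fun z _ => and_iff_left (by rw [Polynomial.map_one, eval_one]; exact one_ne_zero))

/-- **A real polynomial splits over `ℝ` iff all its complex roots are real.** [this file, §719; Mathlib `Splits.roots_map` ∕ `Splits.of_splits_map`] -/
theorem splits_iff_forall_im_eq_zero (P : ℝ[X]) : P.Splits ↔ ∀ z ∈ (P.aroots ℂ).toFinset, z.im = 0 := by
  constructor
  · intro hs z hz
    rw [Multiset.mem_toFinset, aroots_def, hs.roots_map (algebraMap ℝ ℂ), Multiset.mem_map] at hz
    obtain ⟨x, -, rfl⟩ := hz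
    exact Complex.ofReal_im x
  · intro h
    refine Polynomial.Splits.of_splits_map (algebraMap ℝ ℂ) (IsAlgClosed.splits _) fun z hz => ⟨z.re, ?_⟩
    have him := h z (Multiset.mem_toFinset.2 hz)
    exact Complex.ext (by simp) (by simp [him])

/-- **… iff it has no root in the open upper half plane** (the lower ones are their conjugates). [this file, §719] -/
theorem splits_iff_card_upper_eq_zero (P : ℝ[X]) : P.Splits ↔ ((P.aroots ℂ).toFinset.filter fun z => 0 < z.im).card = 0 := by
  rw [splits_iff_forall_im_eq_zero P, Finset.card_eq_zero, Finset.filter_eq_empty_iff]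
  constructor
  · intro h z hz hpos
    exact absurd (h z hz) hpos.ne'
  · intro h z hz
    by_contra hne
    rcases lt_or_gt_of_ne hne with hlt | hgt
    · exact h (Literature.Algebra.Polynomial.HermiteSignature.conj_mem_aroots_toFinset hz) (by rw [Complex.conj_im]; linarith)
    · exact h hz hgt

/-- **REAL-ROOTEDNESS BY INERTIA: `P` splits over `ℝ` ⟺ `sigNeg (vᵀ H_t(P′/P) v) = 0`** for `P` monic real and ANY size `t + 1 ≥ deg P` (Hermite: the negative squares are the conjugate pairs). [this file, §719] -/
theorem splits_iff_sigNeg_hankelSq_eq_zero {t : ℕ} {P : ℝ[X]} (hP : P.Monic) (hPd : P.natDegree ≤ t + 1) :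
    P.Splits ↔ sigNeg (hankelSq ℝ t (dualSeq ℝ P (derivative P))).toQuadraticForm' = 0 := by
  rw [sigNeg_hankelSq_dualSeq_derivative_real_eq_card_upper hP hPd, splits_iff_card_upper_eq_zero P]

/-- A quadratic form that is everywhere `≥ 0` has `sigNeg = 0` (no negative-definite line). [bookkeeping; any finite-dimensional space over an ordered field — PROVED Literature
`Geometry/Lorentzian/PseudoRiemannianMetricProofs.sigNeg_eq_zero_of_nonneg` is the same over `ℝ` (not imported: a pseudo-Riemannian-geometry module), `QuadraticForm/SignatureOrthogonalFamily.sigNeg_eq_zero_of_posDef` the definite case] -/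
theorem sigNeg_eq_zero_of_nonneg {K : Type*} [Field K] [LinearOrder K] [IsStrictOrderedRing K] {M : Type*} [AddCommGroup M] [Module K M] [FiniteDimensional K M] {Q : QuadraticForm K M}
    (h : ∀ x, 0 ≤ Q x) : sigNeg Q = 0 := by
  obtain ⟨V, hV, hneg⟩ := exists_finrank_eq_sigNeg_and_negDef Q
  rw [← hV, Submodule.finrank_eq_zero, Submodule.eq_bot_iff]
  intro x hx
  by_contra hx0
  have h1 := hneg ⟨x, hx⟩ (fun h0 => hx0 (congrArg Subtype.val h0))
  rw [QuadraticMap.restrict_apply, QuadraticMap.neg_apply] at h1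
  exact absurd (h x) (not_le.2 (neg_pos.1 h1))

/-- **`P` splits over `ℝ` ⟺ `vᵀ H_t(P′/P) v ≥ 0` for every real `v`** (`P` monic, any `t + 1 ≥ deg P`; BPR Thm. 4.58 ∕ Rem. 4.59: real-rooted ⟺ `Her(P,1) ⪰ 0`, here for Mathlib's quadratic form of the Hankel matrix; Literature
`HermiteRealRootedness.splits_iff_posSemidef_hermiteMatrix` is the `Matrix.PosSemidef` phrasing for `hermiteMatrix P n`). [this file, §719] -/
theorem splits_iff_hankelSq_nonneg {t : ℕ} {P : ℝ[X]} (hP : P.Monic) (hPd : P.natDegree ≤ t + 1) :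
    P.Splits ↔ ∀ v : Fin (t + 1) → ℝ, 0 ≤ (hankelSq ℝ t (dualSeq ℝ P (derivative P))).toQuadraticForm' v := by
  constructor
  · intro hs v
    exact toQuadraticForm'_hankelSq_dualSeq_derivative_nonneg hP hs t v
  · intro h
    rw [splits_iff_sigNeg_hankelSq_eq_zero hP hPd]
    exact sigNeg_eq_zero_of_nonneg h

end Summit.Ventures.HSemireg.Wedge.HankelOuter
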